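import Mathlib
import Summits.Ventures.PercRepro2.HCov
import Summits.Ventures.PercRepro2.BHKAvoid
import Summits.Ventures.PercRepro2.ExploreA3
import Summits.Ventures.PercRepro2.RootLeafUSigns
import Summits.Ventures.PercRepro2.RootLeafUHalf
import Summits.Ventures.PercRepro2.RootLeafUCore
import Summits.Ventures.PercRepro2.RootLeafUYA
import Summits.Ventures.PercRepro2.RootLeafUSepIndep

/-!
# (G4-u) on the `b`-separating class: the root `a₂` cuts `u` off from `b` (blind cell PercRepro2,
p4 g8; S3 (G4-u), proofs/P4-G8-SEP.md §7)
Setting of `RootLeafUTheorem` / `RootLeafUHalf` (roots `u, a₂`; `L = C(u)`, `K = C(a₂)`,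
`Q = {u ↮ a₂}`; marks `o, c, b`).  The class is **`∀ ω, Conn ω u b → Conn ω u a₂`** (every open
`u–b` connection passes through `a₂`), and the machinery is `RootLeafUSepIndep` with `b` in the
role of `c`: `b ∉ L` on `Q` and `P(Q, X, a₂ ↔ b) = hb · P(Q, X)` for every `L`-event `X`.
* the `o ∈ L` half: every term of `(YB)` carries `b ∈ L`, so `T2oL = 2 (YA) ≥ 0` (`YA_nonneg`);
* the `o ∈ K` half collapses to **`T2oK = 2 (D + d0 Z) · [P(T′, oK, bK) − hb · P(T′, oK)]`**
  (`SepB.T2oK_sepB_eq`), non-negative because in the residual graph `G ∖ C(u)` the events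
  `a₂ ↔ o` and `a₂ ↔ b` are positively correlated (Harris) while `P(a₂ ↔ b in G ∖ C(u)) = hb`
  (`SepB.T2oK_nonneg_of_sepB`);
* **`SepB.HCov_root_leaf_u_of_sepB`**: `0 ≤ T2`, hence (HCOV) for the root-leaf instance from (HCOV)
  for the instance `a₁ := u`, on the `b`-separating class.
-/

namespace Summit.Ventures.PercRepro2

open UnionCluster CovForm

namespace RootLeafU

namespace SepB

section SepB

variable {V : Type*} {E : Type*} [Fintype E] [DecidableEq E] [Fintype V] [DecidableEq V]
  {R : Type*} [Field R] [LinearOrder R] [IsStrictOrderedRing R]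

variable (p : E → R) (ends : E → Sym2 V) (o a₂ c b u : V)

omit [Fintype E] [DecidableEq E] [Fintype V] [DecidableEq V] in
/-- On the class, `b ∉ L` on `Q`: `Q ∩ {u ↔ b} = ∅`. -/
lemma Q_inter_bL_eq_empty (hsep : ∀ ω : Config E, Conn ends ω u b → Conn ends ω u a₂) :
    avoidAll ends a₂ {u} ∩ connEvent ends u b = ∅ := by
  ext ω
  simp only [Set.mem_inter_iff, mem_connEvent, Set.mem_empty_iff_false, iff_false, not_and]
  intro hQ hb
  exact hQ u (Finset.mem_singleton_self u) (conn_symm (hsep ω hb))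

omit [Fintype V] [DecidableEq V] [LinearOrder R] [IsStrictOrderedRing R] in
/-- Any event inside `Q ∩ {u ↔ b}` is null on the class. -/
lemma prob_eq_zero_of_subset (hsep : ∀ ω : Config E, Conn ends ω u b → Conn ends ω u a₂)
    {A : Set (Config E)} (hA : A ⊆ avoidAll ends a₂ {u} ∩ connEvent ends u b) : prob p A = 0 := by
  have : A = ∅ := Set.subset_eq_empty hA (Q_inter_bL_eq_empty ends a₂ b u hsep)
  rw [this, prob_empty]

omit [Fintype E] [DecidableEq E] [Fintype V] [DecidableEq V] in
/-- `PD ⊆ Q`. -/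
lemma PDEvent_subset : PDEvent ends u a₂ c ⊆ avoidAll ends a₂ {u} := by
  intro ω hω
  rw [avoidAll_singleton_eq ends]
  exact fun h => hω.1 (conn_symm h)

omit [Fintype E] [DecidableEq E] [Fintype V] [DecidableEq V] in
/-- `T′ ⊆ Q`. -/
lemma TEvent_swap_subset : TEvent ends a₂ u c ⊆ avoidAll ends a₂ {u} := by
  intro ω hω
  rw [avoidAll_singleton_eq ends]
  exact fun h => hω.1 (conn_symm h)

omit [Fintype E] [DecidableEq E] [Fintype V] [DecidableEq V] in
/-- `T ⊆ Q`. -/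
lemma TEvent_subset : TEvent ends u a₂ c ⊆ avoidAll ends a₂ {u} := by
  intro ω hω
  rw [avoidAll_singleton_eq ends]
  exact hω.1

omit [Fintype E] [DecidableEq E] [Fintype V] in
/-- `R = {u ↮ a₂, u ↮ c}` as `Q` with the `L`-event `c ∉ L`. -/
lemma R_eq : avoidAll ends u {a₂, c} = avoidAll ends a₂ {u} ∩ clusterInEvent ends u {W | c ∉ W} := by
  rw [avoidAll_singleton_eq ends]
  ext ω
  simp only [avoidAll, Set.mem_setOf_eq, Finset.mem_insert, Finset.mem_singleton, forall_eq_or_imp,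
    forall_eq, Set.mem_inter_iff, Set.mem_compl_iff, mem_connEvent, mem_clusterInEvent, mem_cluster]
  constructor
  · rintro ⟨h1, h2⟩
    exact ⟨fun h => h1 (conn_symm h), h2⟩
  · rintro ⟨h1, h2⟩
    exact ⟨fun h => h1 (conn_symm h), h2⟩

omit [Fintype E] [DecidableEq E] [Fintype V] [DecidableEq V] in
/-- `T′ = Q ∩ {c ∈ L}`. -/
lemma TEvent_swap_eq : TEvent ends a₂ u c = avoidAll ends a₂ {u} ∩ clusterInEvent ends u {W | c ∈ W} := by
  rw [avoidAll_singleton_eq ends, ExploreA3.clusterInEvent_mem_eq, connEvent_comm ends a₂ u]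
  rfl

/-- **The `o ∈ K` half on the `b`-separating class**:
`T2oK = 2 (D + d0 Z) · [P(T′, oK, bK) − hb · P(T′, oK)]`. -/
theorem T2oK_sepB_eq (hsep : ∀ ω : Config E, Conn ends ω u b → Conn ends ω u a₂) (hua : u ≠ a₂) :
    T2oK p ends o a₂ c b u =
      2 * (prob p (PDEvent ends u a₂ c) + prob p (avoidAll ends a₂ {c}) * prob p (avoidAll ends a₂ {u})) *
        (prob p (TEvent ends a₂ u c ∩ (connEvent ends a₂ o ∩ connEvent ends a₂ b)) -
          prob p (connEvent ends a₂ b) * prob p (TEvent ends a₂ u c ∩ connEvent ends a₂ o)) := by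
  have hgap := gap_eq_Q p ends u a₂ b
  -- the null masses
  have z1 : prob p (avoidAll ends a₂ {u} ∩ connEvent ends u b) = 0 :=
    prob_eq_zero_of_subset p ends a₂ b u hsep le_rfl
  have z2 : prob p (TEvent ends a₂ u c ∩ connEvent ends u b) = 0 :=
    prob_eq_zero_of_subset p ends a₂ b u hsep
      (Set.inter_subset_inter_left _ (TEvent_swap_subset ends a₂ c u))
  have z3 : prob p (TEvent ends u a₂ c ∩ connEvent ends u b) = 0 :=
    prob_eq_zero_of_subset p ends a₂ b u hsep
      (Set.inter_subset_inter_left _ (TEvent_subset ends a₂ c u))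
  have z4 : prob p (PDEvent ends u a₂ c ∩ connEvent ends u b) = 0 :=
    prob_eq_zero_of_subset p ends a₂ b u hsep
      (Set.inter_subset_inter_left _ (PDEvent_subset ends a₂ c u))
  have z5 : prob p (PDEvent ends u a₂ c ∩ (connEvent ends a₂ o ∩ connEvent ends u b)) = 0 :=
    prob_eq_zero_of_subset p ends a₂ b u hsep
      (fun ω hω => ⟨PDEvent_subset ends a₂ c u hω.1, hω.2.2⟩)
  have z6 : prob p (TEvent ends a₂ u c ∩ (connEvent ends a₂ o ∩ connEvent ends u b)) = 0 :=
    prob_eq_zero_of_subset p ends a₂ b u hsep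
      (fun ω hω => ⟨TEvent_swap_subset ends a₂ c u hω.1, hω.2.2⟩)
  -- the `b ∈ K` masses of `L`-events factorise
  have hQbK := Sep.prob_Q_clusterIn_conn_eq p ends a₂ b u hsep hua Set.univ
  rw [clusterInEvent_univ, Set.inter_univ] at hQbK
  have hTpbK := Sep.prob_Q_clusterIn_conn_eq p ends a₂ b u hsep hua {W | c ∈ W}
  rw [← TEvent_swap_eq ends a₂ c u] at hTpbK
  have hRbK := Sep.prob_Q_clusterIn_conn_eq p ends a₂ b u hsep hua {W | c ∉ W}
  rw [← R_eq ends a₂ c u] at hRbK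
  have hR := ISplit.prob_PD_add_T p ends u a₂ c Set.univ
  have hRbK' := ISplit.prob_PD_add_T p ends u a₂ c (connEvent ends a₂ b)
  rw [Set.inter_univ, Set.inter_univ, Set.inter_univ] at hR
  have hPDbK : prob p (PDEvent ends u a₂ c ∩ connEvent ends a₂ b) =
      prob p (connEvent ends a₂ b) * (prob p (PDEvent ends u a₂ c) + prob p (TEvent ends u a₂ c)) -
        prob p (TEvent ends u a₂ c ∩ connEvent ends a₂ b) := by
    linear_combination hRbK' + hRbK - prob p (connEvent ends a₂ b) * hR
  unfold T2oK Ee EQb3 PDb EQ3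
  rw [prob_univ, hgap, z1, z2, z3, z4, z5, z6, hQbK, hTpbK, hPDbK]
  ring

omit [Fintype V] [DecidableEq V] in
/-- In the residual graph `G ∖ W`, `a₂ ↔ o` and `a₂ ↔ b` are positively correlated (Harris), and for
a `u`-cluster `W` of `Q` the second has probability `hb` (del-invariance): `g_{ob}(W) ≥ hb · g_o(W)`. -/
lemma residual_harris (hp : IsProbVec p)
    (hsep : ∀ ω : Config E, Conn ends ω u b → Conn ends ω u a₂) (hua : u ≠ a₂)
    {ω₀ : Config E} (h₀ : ¬ Conn ends ω₀ u a₂) :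
    prob p (connEvent ends a₂ b) *
        prob p {ω | Conn ends (delConfig ends (cluster ends ω₀ u) ω) a₂ o} ≤
      prob p ({ω | Conn ends (delConfig ends (cluster ends ω₀ u) ω) a₂ o} ∩
        {ω | Conn ends (delConfig ends (cluster ends ω₀ u) ω) a₂ b}) := by
  have hb' : prob p {ω | Conn ends (delConfig ends (cluster ends ω₀ u) ω) a₂ b} =
      prob p (connEvent ends a₂ b) := by
    congr 1
    ext ω
    simp only [Set.mem_setOf_eq, mem_connEvent]
    exact Sep.conn_delConfig_iff hsep hua h₀ ω
  have hup : ∀ x : V, IsUpperSet {ω : Config E | Conn ends (delConfig ends (cluster ends ω₀ u) ω) a₂ x} :=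
    fun x ω ω' h hω => conn_mono (Sep.delConfig_mono _ h) hω
  have h := prob_mul_prob_le_prob_inter hp (hup o) (hup b)
  rw [hb', mul_comm] at h
  exact h

/-- **The `o ∈ K` half is non-negative on the `b`-separating class.** -/
theorem T2oK_nonneg_of_sepB (hp : IsProbVec p)
    (hsep : ∀ ω : Config E, Conn ends ω u b → Conn ends ω u a₂) (hua : u ≠ a₂) :
    0 ≤ T2oK p ends o a₂ c b u := by
  classical
  rw [T2oK_sepB_eq p ends o a₂ c b u hsep hua]
  have hβ : 0 ≤ prob p (PDEvent ends u a₂ c) + prob p (avoidAll ends a₂ {c}) * prob p (avoidAll ends a₂ {u}) :=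
    add_nonneg (prob_nonneg hp _) (mul_nonneg (prob_nonneg hp _) (prob_nonneg hp _))
  refine mul_nonneg (mul_nonneg (by norm_num) hβ) (sub_nonneg.2 ?_)
  -- explore `C(u)` avoiding `{a₂}` with the `L`-event `c ∈ L` and the `K`-events
  have ha2 : a₂ ∈ ({a₂} : Finset V) := by simp
  have tOB := prob_clusterIn_inter_avoid_eq_expect p ends u a₂ ha2 {W | c ∈ W} ({W | o ∈ W} ∩ {W | b ∈ W})
  have tO := prob_clusterIn_inter_avoid_eq_expect p ends u a₂ ha2 {W | c ∈ W} {W | o ∈ W}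
  rw [clusterInEvent_mem_inter_eq] at tOB
  rw [ExploreA3.clusterInEvent_mem_eq ends a₂ o] at tO
  have e1 : clusterInEvent ends u {W | c ∈ W} ∩ (connEvent ends a₂ o ∩ connEvent ends a₂ b) ∩
      avoidAll ends u {a₂} = TEvent ends a₂ u c ∩ (connEvent ends a₂ o ∩ connEvent ends a₂ b) := by
    rw [TEvent_swap_eq ends a₂ c u, Sep.avoidAll_singleton_comm ends a₂ u]
    ext ω
    simp only [Set.mem_inter_iff]
    tauto
  have e2 : clusterInEvent ends u {W | c ∈ W} ∩ connEvent ends a₂ o ∩ avoidAll ends u {a₂} =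
      TEvent ends a₂ u c ∩ connEvent ends a₂ o := by
    rw [TEvent_swap_eq ends a₂ c u, Sep.avoidAll_singleton_comm ends a₂ u]
    ext ω
    simp only [Set.mem_inter_iff]
    tauto
  rw [e1] at tOB
  rw [e2] at tO
  rw [tOB, tO, ← expect_const_mul]
  refine expect_mono hp fun ω => ?_
  by_cases hω : ω ∈ avoidAll ends u {a₂}
  · have h₀ : ¬ Conn ends ω u a₂ := hω a₂ (Finset.mem_singleton_self a₂)
    have key := residual_harris p ends o a₂ b u hp hsep hua h₀
    have hOB : delClusterProb p ends a₂ ({W | o ∈ W} ∩ {W | b ∈ W}) (cluster ends ω u) =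
        prob p ({ω' | Conn ends (delConfig ends (cluster ends ω u) ω') a₂ o} ∩
          {ω' | Conn ends (delConfig ends (cluster ends ω u) ω') a₂ b}) := by
      unfold delClusterProb
      congr 1
    have hO : delClusterProb p ends a₂ {W | o ∈ W} (cluster ends ω u) =
        prob p {ω' | Conn ends (delConfig ends (cluster ends ω u) ω') a₂ o} := by
      unfold delClusterProb
      congr 1
    rw [hOB, hO]
    have h2 : (0 : R) ≤ ({W : Set V | c ∈ W}).indicator 1 (cluster ends ω u) :=
      Set.indicator_apply_nonneg fun _ => zero_le_one
    have h3 : (0 : R) ≤ (avoidAll ends u {a₂}).indicator 1 ω :=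
      Set.indicator_apply_nonneg fun _ => zero_le_one
    calc prob p (connEvent ends a₂ b) * (({W : Set V | c ∈ W}).indicator 1 (cluster ends ω u) *
          prob p {ω' | Conn ends (delConfig ends (cluster ends ω u) ω') a₂ o} *
          (avoidAll ends u {a₂}).indicator 1 ω)
        = ({W : Set V | c ∈ W}).indicator 1 (cluster ends ω u) *
          (prob p (connEvent ends a₂ b) *
            prob p {ω' | Conn ends (delConfig ends (cluster ends ω u) ω') a₂ o}) *
          (avoidAll ends u {a₂}).indicator 1 ω := by ring
      _ ≤ ({W : Set V | c ∈ W}).indicator 1 (cluster ends ω u) *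
          prob p ({ω' | Conn ends (delConfig ends (cluster ends ω u) ω') a₂ o} ∩
            {ω' | Conn ends (delConfig ends (cluster ends ω u) ω') a₂ b}) *
          (avoidAll ends u {a₂}).indicator 1 ω :=
          mul_le_mul_of_nonneg_right (mul_le_mul_of_nonneg_left key h2) h3
  · simp only [Set.indicator_of_notMem hω, mul_zero, le_refl]

/-- **The `o ∈ L` half is non-negative on the `b`-separating class**: `(YB) = 0`, `T2oL = 2 (YA)`. -/
theorem T2oL_nonneg_of_sepB (hp : IsProbVec p)
    (hsep : ∀ ω : Config E, Conn ends ω u b → Conn ends ω u a₂) :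
    0 ≤ T2oL p ends o a₂ c b u := by
  rw [T2oL_eq_YA_add_YB]
  have hYA := YA_nonneg p ends o a₂ c b u hp
  have z1 : prob p (avoidAll ends a₂ {u} ∩ connEvent ends u b) = 0 :=
    prob_eq_zero_of_subset p ends a₂ b u hsep le_rfl
  have z2 : prob p (TEvent ends a₂ u c ∩ connEvent ends u b) = 0 :=
    prob_eq_zero_of_subset p ends a₂ b u hsep
      (Set.inter_subset_inter_left _ (TEvent_swap_subset ends a₂ c u))
  have z4 : prob p (PDEvent ends u a₂ c ∩ connEvent ends u b) = 0 :=
    prob_eq_zero_of_subset p ends a₂ b u hsep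
      (Set.inter_subset_inter_left _ (PDEvent_subset ends a₂ c u))
  have z7 : prob p (TEvent ends u a₂ c ∩ (connEvent ends u o ∩ connEvent ends u b)) = 0 :=
    prob_eq_zero_of_subset p ends a₂ b u hsep
      (fun ω hω => ⟨TEvent_subset ends a₂ c u hω.1, hω.2.2⟩)
  rw [z1, z2, z4, z7]
  linarith

/-- **`0 ≤ T2` on the `b`-separating class.** -/
theorem T2_nonneg_of_sepB (hp : IsProbVec p)
    (hsep : ∀ ω : Config E, Conn ends ω u b → Conn ends ω u a₂) (hua : u ≠ a₂) :
    0 ≤ T2 p ends o a₂ c b u :=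
  T2_nonneg_of_halves p ends o a₂ c b u (T2oL_nonneg_of_sepB p ends o a₂ c b u hp hsep)
    (T2oK_nonneg_of_sepB p ends o a₂ c b u hp hsep hua)

/-- **(G4-u) on the `b`-separating class**: for the root `a₁` a leaf at the unmarked vertex `u`
(edge `f`), if `a₂` separates `u` from `b` (every configuration with `u ↔ b` has `u ↔ a₂`), then
(HCOV) for the root-leaf instance follows from (HCOV) for the instance `a₁ := u`. -/
theorem HCov_root_leaf_u_of_sepB (hp : IsProbVec p) {f : E} {a₁ : V} (hf : ends f = s(a₁, u))
    (hleaf : ∀ e, a₁ ∈ ends e → e = f) (h1u : a₁ ≠ u) (h12 : a₁ ≠ a₂) (h1c : a₁ ≠ c)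
    (h1o : a₁ ≠ o) (h1b : a₁ ≠ b) (hua : u ≠ a₂)
    (hsep : ∀ ω : Config E, Conn ends ω u b → Conn ends ω u a₂)
    (h3 : HCov p ends o u a₂ c b) : HCov p ends o a₁ a₂ c b :=
  HCov_root_leaf_u_of p ends hp hf hleaf h1u h12 h1c h1o h1b
    (T2_nonneg_of_sepB p ends o a₂ c b u hp hsep hua) h3

end SepB

end SepB

end RootLeafU

end Summit.Ventures.PercRepro2
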